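import Summits.Ventures.PercRepro.Night2FatZLoads
import Summits.Ventures.PercRepro.Night2FatZFaces

/-!
# night-2: the fat dichotomy with BOTH the class-line exclusion and the source data

`loaded_fat_target_dichotomy_class` (Night2FatZFaces) strengthens the distance-1 branch of the gen-33 dichotomy by
`rk (R ∪ {w₀, x}) ≥ 4` (no distance-1 load on a class line at a target containing both off-points), and
`loaded_fat_target_dichotomy'` (Night2FatZLoads) exposes in the distance-2 branch the SOURCE's planes
`clF (insert c₂ R) ∪ clF (insert c₃ R) ⊇ H₀`.  The two proofs branch on the same source pair; this file runs
them together: **`loaded_fat_target_dichotomy_full`** carries both pieces of information.  Paper `proofs/NIGHT-2-g35.md` §1.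
-/

namespace PercRepro.Shadow

open PercRepro.ThmH PercRepro.PerFlat

variable {α : Type*} [DecidableEq α] {M : Matroid α} [M.Finite] {G : Finset α}

/-- **The dichotomy with the class-line exclusion AND the source data**: at a target `T ⊆ G` containing both
off-points, a loaded target carries a line `R` which is a distance-1 load (`|R| + 4 = |T ∖ K|`, `rk (G ∖ T) ≥ 3`,
`R` NOT a class line) or a distance-2 load (`|R| + 5 = |T ∖ K|`, `R` a class line, with the source's two planes
through `R` covering `H₀`). -/
theorem loaded_fat_target_dichotomy_full (hG : G ∈ flatsQ M (5 + 1)) (hd : (gr M \ G).card = 2)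
    (hk : kColoops M G = 1) (hs : ∀ e ∈ gr M, ∀ f ∈ gr M, e ≠ f → rkN M {e, f} = 2)
    (hl : ∀ e ∈ gr M, M.Indep {e}) (hfat : (fatClosures M 5 G 2).card ≤ 1) {B₀ : Finset α}
    (hB₀ : B₀ ∈ thinMembers M 5 G) {w₀ x : α} (hD : G \ clF M B₀ = {w₀, x}) (hne : w₀ ≠ x)
    {T : Finset α} (hTG : T ⊆ G) (hw₀T : w₀ ∈ T) (hxT : x ∈ T)
    (hload : dload M 5 G (bigP M G) (dshGT2 M 5 G) T ≠ 0) :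
    ∃ R ⊆ (T \ coloops M G) \ {w₀, x}, rkN M R = 2 ∧ 3 ≤ R.card ∧
      ((R.card + 4 = (T \ coloops M G).card ∧ 3 ≤ rkN M (G \ T) ∧
          4 ≤ rkN M (insert w₀ (insert x R))) ∨
        (R.card + 5 = (T \ coloops M G).card ∧ rkN M (insert w₀ (insert x R)) ≤ 3 ∧
          ∃ c₂ ∈ (T \ coloops M G) \ {w₀, x}, ∃ c₃ ∈ (T \ coloops M G) \ {w₀, x},
            c₂ ∉ clF M R ∧ c₃ ∉ clF M (insert c₂ R) ∧
            ∀ e ∈ (G \ coloops M G) \ {w₀, x}, e ∈ clF M (insert c₂ R) ∨ e ∈ clF M (insert c₃ R))) := by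
  obtain ⟨B, hB, hbig, z, hz, hloss, hcase⟩ := exists_pair_of_dload_ne_zero' hG hd hk hs hl hfat hload
  obtain ⟨hR2, hRcard⟩ := rkN_sdiff_coloops_eq_two_of_loss_ne_zero hG hd hk hs hl hB hbig hz hloss
  have hcop : ¬ (gtPts M 5 G (insert z B)).Nonempty → rkN M (insert w₀ (insert x
      ((insert z B \ coloops M G) \ coloops M (insert z B \ coloops M G)))) ≤ 3 :=
    fun hno => rkN_line_off_le_three_of_no_gtPts hG hd hk hs hl hB₀ hD hB hbig hz hloss hno
  obtain ⟨R, hRdef⟩ : ∃ R : Finset α,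
      R = (insert z B \ coloops M G) \ coloops M (insert z B \ coloops M G) := ⟨_, rfl⟩
  rw [← hRdef] at hR2 hRcard hcop
  have hGg : G ⊆ gr M := (mem_flatsQ.1 hG).1
  have hd' : (gr M \ G).card ≤ 5 := by omega
  have hQG : insert z B ⊆ G :=
    Finset.insert_subset (Finset.mem_sdiff.1 hz).1 (subset_G_of_mem_thinMembers hB)
  have hKB : coloops M G ⊆ B := coloops_subset_of_mem_thinMembers hG hd' hB
  have hKQ : coloops M G ⊆ insert z B := hKB.trans (Finset.subset_insert _ _)
  have hzB : z ∉ B := fun h' => (Finset.mem_sdiff.1 hz).2 (subset_clF_of_subset_gr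
    ((subset_G_of_mem_thinMembers hB).trans hGg) h')
  have hzK : z ∉ coloops M G := fun h' => hzB (hKB h')
  have hQ'6 : 6 ≤ (insert z B \ coloops M G).card := by
    have heq : insert z B \ coloops M G = insert z (B \ coloops M G) := by
      ext e
      simp only [Finset.mem_sdiff, Finset.mem_insert]
      constructor
      · rintro ⟨h' | h', h2⟩
        · exact Or.inl h'
        · exact Or.inr ⟨h', h2⟩
      · rintro (rfl | ⟨h', h2⟩)
        · exact ⟨Or.inl rfl, hzK⟩
        · exact ⟨Or.inr h', h2⟩
    rw [heq, Finset.card_insert_of_notMem (fun h' => hzB (Finset.mem_sdiff.1 h').1)]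
    omega
  have hR3 : 3 ≤ R.card := by omega
  have hRQ' : R ⊆ insert z B \ coloops M G := by
    rw [hRdef]
    exact Finset.sdiff_subset
  have hRG : R ⊆ G := hRQ'.trans (Finset.sdiff_subset.trans hQG)
  have hoff := notMem_or_notMem_insert_of_loss_ne_zero hG hd hk hs hl hB₀ hD hB hbig hz hloss
  have hRoff : ∀ u v : α, ({w₀, x} : Finset α) = {u, v} → u ∉ insert z B → u ∉ R ∧ v ∉ R := by
    intro u v huv huQ
    have huR : u ∉ R := fun h' => huQ (Finset.mem_sdiff.1 (hRQ' h')).1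
    exact ⟨huR, notMem_of_rkN_le_two_of_notMem hs hG hD hRG (by omega) hR3
      (by rw [huv]; exact Finset.pair_comm _ _) huR⟩
  have hw₀x : w₀ ∉ R ∧ x ∉ R := by
    rcases hoff with h' | h'
    · exact hRoff w₀ x rfl h'
    · exact (hRoff x w₀ (Finset.pair_comm _ _) h').symm
  have h4 := four_le_rkN_sdiff_insert_of_loss_ne_zero hG hd hk hs hl hB hbig hz hloss
  rcases hcase with ⟨-, x', hx', rfl⟩ | ⟨hno, p, hp, rfl⟩
  · obtain ⟨hx'G, hx'Q⟩ := Finset.mem_sdiff.1 (mem_goodPts.1 hx').1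
    have hx'K : x' ∉ coloops M G := fun h' => hx'Q (hKQ h')
    refine ⟨R, ?_, hR2, hR3, Or.inl ⟨?_, ?_, ?_⟩⟩
    · intro r hr
      rw [Finset.mem_sdiff, Finset.mem_insert, Finset.mem_singleton]
      refine ⟨Finset.sdiff_subset_sdiff (Finset.subset_insert _ _) (Finset.Subset.refl _) (hRQ' hr), ?_⟩
      rintro (rfl | rfl)
      · exact hw₀x.1 hr
      · exact hw₀x.2 hr
    · have heq : insert x' (insert z B) \ coloops M G = insert x' (insert z B \ coloops M G) := by
        ext e
        simp only [Finset.mem_sdiff, Finset.mem_insert]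
        constructor
        · rintro ⟨h' | h', h2⟩
          · exact Or.inl h'
          · exact Or.inr ⟨h', h2⟩
        · rintro (rfl | ⟨h', h2⟩)
          · exact ⟨Or.inl rfl, hx'K⟩
          · exact ⟨Or.inr h', h2⟩
      rw [heq, Finset.card_insert_of_notMem (fun h' => hx'Q (Finset.mem_sdiff.1 h').1)]
      omega
    · have heq : G \ insert z B = insert x' (G \ insert x' (insert z B)) := by
        ext e
        simp only [Finset.mem_sdiff, Finset.mem_insert, not_or]
        constructor
        · rintro ⟨heG, heQ⟩
          by_cases hex : e = x'
          · exact Or.inl hex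
          · exact Or.inr ⟨heG, hex, heQ⟩
        · rintro (rfl | ⟨heG, -, heQ⟩)
          · refine ⟨hx'G, ?_⟩
            rwa [Finset.mem_insert, not_or] at hx'Q
          · exact ⟨heG, heQ⟩
      rw [heq] at h4
      have := rkN_insert_le_succ (M := M) (G \ insert x' (insert z B)) x'
      omega
    · -- the line of a distance-1 load is never a class line
      by_contra hcls
      have hcls' : rkN M (insert w₀ (insert x R)) ≤ 3 := by omega
      rw [hRdef] at hcls'
      rcases hoff with hw | hx
      · have hw' : w₀ = x' := by
          rw [Finset.mem_insert] at hw₀T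
          rcases hw₀T with h' | h'
          · exact h'
          · exact absurd h' hw
        have hxQ : x ∈ insert z B := by
          rw [Finset.mem_insert] at hxT
          rcases hxT with h' | h'
          · exact absurd (h'.trans hw'.symm).symm hne
          · exact h'
        have := notMem_gtPts_of_class_line hG hd hk hs hl hB₀ hD hB hbig hz hloss hcls'
          (u := x) (p := w₀) (Finset.pair_comm _ _) hxQ hw
        rw [hw'] at this
        exact this hx'
      · have hx'' : x = x' := by
          rw [Finset.mem_insert] at hxT
          rcases hxT with h' | h'
          · exact h'
          · exact absurd h' hx
        have hwQ : w₀ ∈ insert z B := by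
          rw [Finset.mem_insert] at hw₀T
          rcases hw₀T with h' | h'
          · exact absurd (h'.trans hx''.symm) hne
          · exact h'
        have := notMem_gtPts_of_class_line hG hd hk hs hl hB₀ hD hB hbig hz hloss hcls'
          (u := w₀) (p := x) rfl hwQ hx
        rw [hx''] at this
        exact this hx'
  · -- distance two: the source `(B, z)` has no good point (as in `loaded_fat_target_dichotomy'`)
    obtain ⟨R₁, hR₁Q, hR₁2, hR₁3, hR₁card, hcop₁, c₂, hc₂, c₃, hc₃, hc₂R, hc₃R, hcover⟩ :=
      exists_two_planes_of_no_gtPts hG hd hk hs hl hB₀ hD hB hbig hz hloss hno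
    have hQT : insert z B ⊆ insert p.1 (insert p.2 (insert z B)) :=
      (Finset.subset_insert _ _).trans (Finset.subset_insert _ _)
    have hsub : (insert z B \ coloops M G) \ {w₀, x} ⊆
        (insert p.1 (insert p.2 (insert z B)) \ coloops M G) \ {w₀, x} :=
      Finset.sdiff_subset_sdiff (Finset.sdiff_subset_sdiff hQT (Finset.Subset.refl _)) (Finset.Subset.refl _)
    obtain ⟨⟨hp1, hp2⟩, hp12, -⟩ := mem_d2Pts.1 hp
    have hp1Q : p.1 ∉ insert z B := (Finset.mem_sdiff.1 hp1).2
    have hp2Q : p.2 ∉ insert z B := (Finset.mem_sdiff.1 hp2).2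
    have hp1K : p.1 ∉ coloops M G := fun h' => hp1Q (hKQ h')
    have hp2K : p.2 ∉ coloops M G := fun h' => hp2Q (hKQ h')
    refine ⟨R₁, hR₁Q.trans hsub, hR₁2, hR₁3, Or.inr ⟨?_, hcop₁, c₂, hsub hc₂, c₃, hsub hc₃, hc₂R, hc₃R, hcover⟩⟩
    have heq : insert p.1 (insert p.2 (insert z B)) \ coloops M G =
        insert p.1 (insert p.2 (insert z B \ coloops M G)) := by
      ext e
      simp only [Finset.mem_sdiff, Finset.mem_insert]
      constructor
      · rintro ⟨h' | h' | h', h2⟩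
        · exact Or.inl h'
        · exact Or.inr (Or.inl h')
        · exact Or.inr (Or.inr ⟨h', h2⟩)
      · rintro (rfl | rfl | ⟨h', h2⟩)
        · exact ⟨Or.inl rfl, hp1K⟩
        · exact ⟨Or.inr (Or.inl rfl), hp2K⟩
        · exact ⟨Or.inr (Or.inr h'), h2⟩
    rw [heq, Finset.card_insert_of_notMem, Finset.card_insert_of_notMem
      (fun h' => hp2Q (Finset.mem_sdiff.1 h').1)]
    · omega
    · rw [Finset.mem_insert, Finset.mem_sdiff]
      rintro (h' | ⟨h', -⟩)
      · exact hp12 h'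
      · exact hp1Q h'

end PercRepro.Shadow
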